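import Summits.CriticalPhenomena.Ising3D.Control2DIsingData
import Summits.CriticalPhenomena.Ising3D.Control2DOpeEpsRungs
import Mathlib.Tactic
import HarnessLib

/-!
# The 2D Ising witness, VIII: spectrum, OPE data, and the `A2D′` classes at `Δ_σ = 1/8` inhabited
(cell `pub-ising3x`, seat controls-1 gen 37; NON-VACUITY of the 2D control's `A2D′` classes at
`Δ_σ = 1/8` by the Ising datum — CONTROL-ONLY)

HONEST FRAMING: lottery ticket; floor = tightest certified 3D Ising CFT bounds; no exact-solution
claim without a proof. CONTROL-ONLY (`d = 2`); this file is about the two-dimensional Ising CFT only.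

The spectrum of `isingData2D` (`Control2DIsingData`): `Δ_ε = 1`; scalars in `{1} ∪ [4, ∞)`
(`isingData2D_scalarsIn`; the labels `(h,h) = (2j,2j)`, `j ≥ 1`, and `(2j+1/2, 2j+1/2)`); spin 2 in
`{2} ∪ [3, ∞)` (`isingData2D_spinTwoIn`; the stress tensor `(2,0)` and `Δ ≥ 6`, resp. `≥ 3`); total `(2,2)`
coefficient `p_T = A_1 A_0 = 1/64 = (1/8)²/(2 · (1/2))` — the Ward value at `c = 1/2`
(`isingData2D_stressCoeff`); in-box scalar coefficient `p_ε = B_0²/2 = 1/8`, i.e. `λ²_{σσε} = 1/4`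
(`isingData2D_boxCoeff`). Hence the 2D Ising datum inhabits, AT THE CONTROL'S COLUMN `s = 1/8`, the
hypothesis class `A2D′` with `(G, δ) = (2, 1)` of every class-1 / `c` / `λ²` statement of the control
(`isingData2D_A2D`), and every such CERTIFIED statement is a true statement about Onsager–BPZ data:

* `twoSided_ising`   : `TwoSided (1/8) 2 1 w ε_lo U`, `w ≤ 1`      ⟹ `ε_lo < 1 < U`;
* `cTwoSided_ising`  : `CTwoSided (1/8) 2 1 e₁ e₂ c_lo c_hi`, `1 ∈ [e₁,e₂]` ⟹ `c_lo < 1/2 < c_hi`;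
* `pBoxTwoSided_ising` : `PBoxTwoSided (1/8) 2 1 e₁ e₂ lo hi`, `1 ∈ [e₁,e₂]`, `e₂ < 4` ⟹ `lo < 1/8 < hi`;
* `gapExcluded_ising` : `GapExcluded (1/8) U ⟹ 1 < U` (the one-sided threshold is `≥ 1`; with the record
  `GapExcluded (1/8) (20001/20000)` it lies in `(1, 1.00005]` — `Control2DRecordIsing`);
* `opeBound_ising`, `boxExcluded_ising`, `not_excludedAt_ising_one`.

References: A. A. Belavin, A. M. Polyakov, A. B. Zamolodchikov, Nucl. Phys. B 241 (1984) 333, §5, App. E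
[cite: BelavinPolyakovZamolodchikov1984, App. E]; R. Rattazzi, V. S. Rychkov, E. Tonni, A. Vichi,
JHEP 12 (2008) 031, §5 [cite: RattazziEtAl2008, §5]. Tree: `isingData2D`, `isingData2D_isUnitary`,
`isingData2D_satisfiesCrossing`, `isingA_one`, `isingB_zero`, `ScalarsIn`, `SpinTwoIn`, `stressCoeff`,
`boxCoeff`, `TwoSided`, `CTwoSided`, `PBoxTwoSided`, `GapExcluded`, `OpeBound`, `BoxExcluded`, `ExcludedAt`.
-/

namespace Summit.CriticalPhenomena.Ising3D.Control2D

open Set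
open Literature.MathematicalPhysics.QuantumFieldTheory.ConformalBootstrap3D

/-! ### The spectrum -/

/-- **Scalars of the Ising datum**: `Δ ∈ {1} ∪ [4, ∞)` (`ε` at `1`; `(2j,2j)`, `j ≥ 1`, at `4j`;
`(2j+1/2,2j+1/2)`, `j ≥ 1`, at `4j+1`). [cite: BelavinPolyakovZamolodchikov1984, App. E] -/
theorem isingData2D_scalarsIn : isingData2D.ScalarsIn ({1} ∪ Ici 4) := by
  rintro (⟨⟨j, j'⟩, hle, hne⟩ | ⟨⟨j, j'⟩, hle⟩) hi
  · have h0 : 2 * (j - j') = 0 := hi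
    have hjj : j = j' := by omega
    subst hjj
    have hj : 1 ≤ j := by
      by_contra h; apply hne; simp only [Prod.mk.injEq]; omega
    right
    show (4 : ℝ) ≤ 2 * (j : ℝ) + 2 * (j : ℝ)
    have : (1 : ℝ) ≤ j := by exact_mod_cast hj
    linarith
  · have h0 : 2 * (j - j') = 0 := hi
    have hjj : j = j' := by omega
    subst hjj
    rcases Nat.eq_zero_or_pos j with hj | hj
    · subst hj; left; show 2 * ((0 : ℕ) : ℝ) + 2 * ((0 : ℕ) : ℝ) + 1 = 1; simp
    · right
      show (4 : ℝ) ≤ 2 * (j : ℝ) + 2 * (j : ℝ) + 1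
      have : (1 : ℝ) ≤ j := by exact_mod_cast hj
      linarith

/-- **Spin-2 content of the Ising datum**: `Δ ∈ {2} ∪ [3, ∞)` (the stress tensor `(2,0)`; `(2j+2,2j)`,
`j ≥ 1`, at `4j+2 ≥ 6`; `(2j+5/2, 2j+1/2)` at `4j+3`). [cite: BelavinPolyakovZamolodchikov1984, App. E] -/
theorem isingData2D_spinTwoIn : isingData2D.SpinTwoIn ({2} ∪ Ici 3) := by
  rintro (⟨⟨j, j'⟩, hle, hne⟩ | ⟨⟨j, j'⟩, hle⟩) hi
  · have h2 : 2 * (j - j') = 2 := hi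
    have hj : j = j' + 1 := by omega
    subst hj
    rcases Nat.eq_zero_or_pos j' with hj' | hj'
    · subst hj'; left; show 2 * (((0 + 1 : ℕ) : ℝ)) + 2 * ((0 : ℕ) : ℝ) = 2; norm_num
    · right
      show (3 : ℝ) ≤ 2 * (((j' + 1 : ℕ) : ℝ)) + 2 * (j' : ℝ)
      push_cast
      have : (1 : ℝ) ≤ j' := by exact_mod_cast hj'
      linarith
  · have h2 : 2 * (j - j') = 2 := hi
    have hj : j = j' + 1 := by omega
    subst hj
    right
    show (3 : ℝ) ≤ 2 * (((j' + 1 : ℕ) : ℝ)) + 2 * (j' : ℝ) + 1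
    push_cast
    have : (0 : ℝ) ≤ j' := Nat.cast_nonneg j'
    linarith

/-- **Scalar gap of the Ising datum**: every scalar has `Δ ≥ 1 = Δ_ε`. [cite: BelavinPolyakovZamolodchikov1984, App. E] -/
theorem isingData2D_hasScalarGap : isingData2D.HasScalarGap 1 := by
  intro i hi
  rcases isingData2D_scalarsIn i hi with h | h
  · rw [Set.mem_singleton_iff] at h; rw [h]
  · have : (4 : ℝ) ≤ isingData2D.Δ i := h; linarith

/-- **The Ising datum satisfies `A2D′` with `(G, δ) = (2, 1)` at the `ε` location `x = 1`**: scalars in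
`{1} ∪ [2, ∞)`, spin 2 in `{2} ∪ [2+1, ∞)`. [cite: RattazziEtAl2008, §5] -/
theorem isingData2D_A2D :
    isingData2D.ScalarsIn ({1} ∪ Ici 2) ∧ isingData2D.SpinTwoIn ({2} ∪ Ici (2 + 1)) := by
  refine ⟨fun i hi => ?_, fun i hi => ?_⟩
  · rcases isingData2D_scalarsIn i hi with h | h
    · exact Or.inl h
    · right; have : (4 : ℝ) ≤ isingData2D.Δ i := h; show (2 : ℝ) ≤ isingData2D.Δ i; linarith
  · rcases isingData2D_spinTwoIn i hi with h | h
    · exact Or.inl h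
    · right; have : (3 : ℝ) ≤ isingData2D.Δ i := h; show (2 : ℝ) + 1 ≤ isingData2D.Δ i; linarith

/-- With an `ε` box `[e₁, e₂] ∋ 1` the Ising datum has its scalars in `[e₁, e₂] ∪ [2, ∞)`. [folklore] -/
theorem isingData2D_scalarsIn_box {e₁ e₂ : ℝ} (h₁ : e₁ ≤ 1) (h₂ : 1 ≤ e₂) :
    isingData2D.ScalarsIn (Icc e₁ e₂ ∪ Ici 2) := by
  intro i hi
  rcases isingData2D_A2D.1 i hi with h | h
  · rw [Set.mem_singleton_iff] at h; rw [h]; exact Or.inl ⟨h₁, h₂⟩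
  · exact Or.inr h

/-! ### The stress tensor and `ε` coefficients -/

/-- The stress-tensor label `(j,j') = (1,0)`: `(h,h̄) = (2,0)`. [folklore] -/
def isingStressLabel : IsingIdLabel := ⟨(1, 0), by decide, by decide⟩

/-- The stress-tensor label carries `(Δ, ℓ, p) = (2, 2, 1/64)`: `p_T = A_1 A_0 = (1/8)²/(2·(1/2))`, the Ward
value at `c = 1/2`. [cite: BelavinPolyakovZamolodchikov1984, §5] -/
theorem isingData2D_stressLabel :
    isingData2D.Δ (Sum.inl isingStressLabel) = 2 ∧ isingData2D.spin (Sum.inl isingStressLabel) = 2 ∧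
      isingData2D.p (Sum.inl isingStressLabel) = 1 / 64 := by
  refine ⟨by show 2 * ((1 : ℕ) : ℝ) + 2 * ((0 : ℕ) : ℝ) = 2; norm_num, rfl, ?_⟩
  show (if 0 < 1 then isingA 1 * isingA 0 else isingA 1 ^ 2 / 2) = 1 / 64
  rw [if_pos Nat.zero_lt_one, isingA_one, isingA_zero, mul_one]

/-- Every other label is off the `(2,2)` location. [folklore] -/
theorem isingData2D_stress_indicator_of_ne (i : isingData2D.ι) (hi : i ≠ Sum.inl isingStressLabel) :
    isingData2D.stressSet.indicator isingData2D.p i = 0 := by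
  refine Set.indicator_of_notMem ?_ _
  rintro ⟨hΔ, hsp⟩
  rcases i with ⟨⟨j, j'⟩, hle, hne⟩ | ⟨⟨j, j'⟩, hle⟩
  · have hsp' : 2 * (j - j') = 2 := hsp
    have hΔ' : 2 * (j : ℝ) + 2 * (j' : ℝ) = 2 := hΔ
    obtain rfl : j = j' + 1 := by omega
    push_cast at hΔ'
    have : (j' : ℝ) = 0 := by linarith
    have hj' : j' = 0 := by exact_mod_cast this
    subst hj'
    exact hi rfl
  · have hΔ' : 2 * (j : ℝ) + 2 * (j' : ℝ) + 1 = 2 := hΔ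
    have h1 : (2 * (j + j') : ℕ) = 1 := by
      have : (2 * ((j : ℝ) + j')) = 1 := by linarith
      exact_mod_cast (by push_cast; linarith : ((2 * (j + j') : ℕ) : ℝ) = 1)
    omega

/-- **The total `(2,2)` coefficient of the Ising datum is the Ward value at `c = 1/2`**:
`stressCoeff = 1/64 = (1/8)²/(2 · (1/2))`. [cite: BelavinPolyakovZamolodchikov1984, §5] -/
theorem isingData2D_stressCoeff : isingData2D.stressCoeff = 1 / 64 := by
  unfold CrossingData.stressCoeff
  rw [tsum_eq_single _ isingData2D_stress_indicator_of_ne]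
  have hmem : (Sum.inl isingStressLabel : isingData2D.ι) ∈ isingData2D.stressSet :=
    ⟨isingData2D_stressLabel.1, isingData2D_stressLabel.2.1⟩
  exact (Set.indicator_of_mem hmem _).trans isingData2D_stressLabel.2.2

/-- The `ε` label `(j,j') = (0,0)` of the `ε` family: `(h,h̄) = (1/2,1/2)`. [folklore] -/
def isingEpsLabel : IsingEpLabel := ⟨(0, 0), le_rfl⟩

/-- The `ε` label carries `(Δ, ℓ, p) = (1, 0, 1/8)` (`p_ε = B_0²/2`; `λ²_{σσε} = 2 p_ε = 1/4`).
[cite: BelavinPolyakovZamolodchikov1984, §5] -/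
theorem isingData2D_epsLabel :
    isingData2D.Δ (Sum.inr isingEpsLabel) = 1 ∧ isingData2D.spin (Sum.inr isingEpsLabel) = 0 ∧
      isingData2D.p (Sum.inr isingEpsLabel) = 1 / 8 := by
  refine ⟨by show 2 * ((0 : ℕ) : ℝ) + 2 * ((0 : ℕ) : ℝ) + 1 = 1; norm_num, rfl, ?_⟩
  show (if 0 < 0 then isingB 0 * isingB 0 else isingB 0 ^ 2 / 2) = 1 / 8
  rw [if_neg (lt_irrefl 0), isingB_zero]; norm_num

/-- With `1 ∈ [e₁, e₂]` and `e₂ < 4`, the only label in the `ε` box is the `ε` label. [folklore] -/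
theorem isingData2D_box_indicator_of_ne {e₁ e₂ : ℝ} (h₂ : e₂ < 4) (i : isingData2D.ι)
    (hi : i ≠ Sum.inr isingEpsLabel) : (isingData2D.boxSet e₁ e₂).indicator isingData2D.p i = 0 := by
  refine Set.indicator_of_notMem ?_ _
  rintro ⟨hsp, hΔ⟩
  rcases isingData2D_scalarsIn i hsp with h | h
  · -- `Δ = 1`: only the `ε` label
    rcases i with ⟨⟨j, j'⟩, hle, hne⟩ | ⟨⟨j, j'⟩, hle⟩
    · have hsp' : 2 * (j - j') = 0 := hsp
      have hΔ1 : 2 * (j : ℝ) + 2 * (j' : ℝ) = 1 := h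
      have : (2 * (j + j') : ℕ) = 1 := by exact_mod_cast (by push_cast; linarith : ((2 * (j + j') : ℕ) : ℝ) = 1)
      omega
    · have hsp' : 2 * (j - j') = 0 := hsp
      have hΔ1 : 2 * (j : ℝ) + 2 * (j' : ℝ) + 1 = 1 := h
      have hsum : ((j + j' : ℕ) : ℝ) = 0 := by push_cast; linarith
      have hjj : j + j' = 0 := by exact_mod_cast hsum
      obtain rfl : j = 0 := by omega
      obtain rfl : j' = 0 := by omega
      exact hi rfl
  · have h4 : (4 : ℝ) ≤ isingData2D.Δ i := h
    linarith [hΔ.2]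

/-- **The in-box scalar coefficient of the Ising datum is `p_ε = 1/8`** (`λ²_{σσε} = 1/4`) for every `ε` box
`[e₁, e₂] ∋ 1` with `e₂ < 4`. [cite: BelavinPolyakovZamolodchikov1984, §5] -/
theorem isingData2D_boxCoeff {e₁ e₂ : ℝ} (h₁ : e₁ ≤ 1) (h₂ : 1 ≤ e₂) (h₄ : e₂ < 4) :
    isingData2D.boxCoeff e₁ e₂ = 1 / 8 := by
  unfold CrossingData.boxCoeff
  rw [tsum_eq_single _ (isingData2D_box_indicator_of_ne h₄)]
  have hmem : (Sum.inr isingEpsLabel : isingData2D.ι) ∈ isingData2D.boxSet e₁ e₂ :=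
    ⟨isingData2D_epsLabel.2.1, by rw [isingData2D_epsLabel.1]; exact ⟨h₁, h₂⟩⟩
  exact (Set.indicator_of_mem hmem _).trans isingData2D_epsLabel.2.2

/-! ### Every certified statement of the control at `s = 1/8` is a true statement about the Ising data -/

/-- **`A2D′ (2,1)` at `Δ_σ = 1/8` is inhabited, with `ε` location `1`, stress coefficient `1/64`.**
[cite: BelavinPolyakovZamolodchikov1984, App. E] -/
theorem a2d_class_nonvacuous_eighth :
    ∃ D : CrossingData, D.IsUnitary ∧ D.SatisfiesCrossing (1 / 8 : ℝ) ∧ D.ScalarsIn ({1} ∪ Ici 2) ∧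
      D.SpinTwoIn ({2} ∪ Ici (2 + 1)) ∧ D.stressCoeff = 1 / 64 :=
  ⟨isingData2D, isingData2D_isUnitary, isingData2D_satisfiesCrossing, isingData2D_A2D.1, isingData2D_A2D.2,
    isingData2D_stressCoeff⟩

/-- **Every certified class-1 interval contains `Δ_ε = 1`**: `TwoSided (1/8) 2 1 w ε_lo U` with `w ≤ 1`
gives `ε_lo < 1 < U`. [cite: RattazziEtAl2008, §5] -/
theorem twoSided_ising {w εlo U : ℝ} (h : TwoSided (1 / 8) 2 1 w εlo U) (hw : w ≤ 1) : εlo < 1 ∧ 1 < U :=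
  h isingData2D isingData2D_isUnitary isingData2D_satisfiesCrossing isingData2D_A2D.2 1 hw isingData2D_A2D.1

/-- **The location `Δ_ε = 1` is not excludable** under `A2D′ (2,1)` at `Δ_σ = 1/8`. [cite: RattazziEtAl2008, §5] -/
theorem not_excludedAt_ising_one : ¬ ExcludedAt (1 / 8) 2 1 1 := fun h =>
  h isingData2D isingData2D_isUnitary isingData2D_satisfiesCrossing isingData2D_A2D.1 isingData2D_A2D.2

/-- **Every certified box misses `Δ_ε = 1`**: `BoxExcluded (1/8) 2 1 e₁ e₂ → 1 ∉ [e₁, e₂]`. [cite: RattazziEtAl2008, §5] -/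
theorem boxExcluded_ising {e₁ e₂ : ℝ} (h : BoxExcluded (1 / 8) 2 1 e₁ e₂) : (1 : ℝ) ∉ Icc e₁ e₂ :=
  fun hmem => h isingData2D isingData2D_isUnitary isingData2D_satisfiesCrossing
    (isingData2D_scalarsIn_box hmem.1 hmem.2) isingData2D_A2D.2

/-- **The one-sided threshold is at least `Δ_ε = 1`**: `GapExcluded (1/8) U → 1 < U` (every scalar of the Ising
datum has `Δ ≥ 1`). [cite: RattazziEtAl2008, §5] -/
theorem gapExcluded_ising {U : ℝ} (h : GapExcluded (1 / 8) U) : 1 < U := by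
  by_contra hU
  exact h isingData2D isingData2D_isUnitary isingData2D_satisfiesCrossing
    (isingData2D_hasScalarGap.mono (not_lt.mp hU))

/-- **Every certified `c` interval whose `ε` box contains `1` contains `c = 1/2`**:
`CTwoSided (1/8) 2 1 e₁ e₂ c_lo c_hi → c_lo < 1/2 < c_hi` (the datum's `(2,2)` total is `(1/8)²/(2·(1/2))`).
[cite: BelavinPolyakovZamolodchikov1984, §5] -/
theorem cTwoSided_ising {e₁ e₂ clo chi : ℝ} (h : CTwoSided (1 / 8) 2 1 e₁ e₂ clo chi) (h₁ : e₁ ≤ 1)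
    (h₂ : 1 ≤ e₂) : clo < 1 / 2 ∧ 1 / 2 < chi :=
  h isingData2D isingData2D_isUnitary isingData2D_satisfiesCrossing (isingData2D_scalarsIn_box h₁ h₂)
    isingData2D_A2D.2 (1 / 2) (by norm_num) (by rw [isingData2D_stressCoeff]; norm_num)

/-- **Every certified `p_T` bound is a bound on `1/64`**: upper `OpeUpperA2D … P → 1/64 < P`, lower
`OpeLowerA2D … P → P < 1/64` (box `∋ 1`). [cite: RattazziEtAl2008, §5] -/
theorem opeA2D_ising {e₁ e₂ P : ℝ} (h₁ : e₁ ≤ 1) (h₂ : 1 ≤ e₂) :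
    (OpeUpperA2D (1 / 8) 2 1 e₁ e₂ P → 1 / 64 < P) ∧ (OpeLowerA2D (1 / 8) 2 1 e₁ e₂ P → P < 1 / 64) := by
  constructor <;> intro h <;> have := h isingData2D isingData2D_isUnitary isingData2D_satisfiesCrossing
    (isingData2D_scalarsIn_box h₁ h₂) isingData2D_A2D.2 <;> rwa [isingData2D_stressCoeff] at this

/-- **Every certified OPE bound under a scalar gap `≤ 1` is a bound on `1/64`**: `OpeBound (1/8) U P`, `U ≤ 1`
⟹ `1/64 < P`. [cite: RattazziEtAl2008, §5] -/
theorem opeBound_ising {U P : ℝ} (hU : U ≤ 1) (h : OpeBound (1 / 8) U P) : 1 / 64 < P := by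
  have := h isingData2D isingData2D_isUnitary isingData2D_satisfiesCrossing
    (isingData2D_hasScalarGap.mono hU) (Sum.inl isingStressLabel) isingData2D_stressLabel.1
    isingData2D_stressLabel.2.1
  rwa [isingData2D_stressLabel.2.2] at this

/-- **Every certified `p_box` interval around `Δ_ε = 1` contains `p_ε = 1/8`** (`λ²_{σσε} = 1/4`):
`PBoxTwoSided (1/8) 2 1 e₁ e₂ lo hi`, `1 ∈ [e₁, e₂]`, `e₂ < 4` ⟹ `lo < 1/8 < hi`. [cite: RattazziEtAl2008, §5] -/
theorem pBoxTwoSided_ising {e₁ e₂ lo hi : ℝ} (h : PBoxTwoSided (1 / 8) 2 1 e₁ e₂ lo hi) (h₁ : e₁ ≤ 1)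
    (h₂ : 1 ≤ e₂) (h₄ : e₂ < 4) : lo < 1 / 8 ∧ 1 / 8 < hi := by
  have := h isingData2D isingData2D_isUnitary isingData2D_satisfiesCrossing (isingData2D_scalarsIn_box h₁ h₂)
    isingData2D_A2D.2
  rwa [isingData2D_boxCoeff h₁ h₂ h₄] at this

end Summit.CriticalPhenomena.Ising3D.Control2D
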